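import Mathlib
import Summits.Ventures.PercRepro2.LocRows
import Summits.Ventures.PercRepro2.SwRow
import Summits.Ventures.PercRepro2.SwOut
import Summits.Ventures.PercRepro2.SwAllRow
import Summits.Ventures.PercRepro2.SwOutAll
import Summits.Ventures.PercRepro2.SwOutArmFlip
import Summits.Ventures.PercRepro2.SwOutArmThm
import Summits.Ventures.PercRepro2.SwOutCoreDefs
import Summits.Ventures.PercRepro2.SwOutCoreHull
import Summits.Ventures.PercRepro2.SwOutCoreDual
import Summits.Ventures.PercRepro2.SwOutShadowDefs
import Summits.Ventures.PercRepro2.SwOutShadowCube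
import Summits.Ventures.PercRepro2.SwOutCoreShadowDefs
import Summits.Ventures.PercRepro2.SwOutCoreShadow
import Summits.Ventures.PercRepro2.SwOutCoreShadowArm
import Summits.Ventures.PercRepro2.SwOutJunction
import Summits.Ventures.PercRepro2.SwOutJunctionRegion
import Summits.Ventures.PercRepro2.SwOutCoreKey
import Summits.Ventures.PercRepro2.SwOutJunctionH1Defs
import Summits.Ventures.PercRepro2.SwOutJunctionH1Arms
import Summits.Ventures.PercRepro2.SwOutEdgeDefs
import Summits.Ventures.PercRepro2.SwOutEdgeHull
import Summits.Ventures.PercRepro2.SwOutEdgeDual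
import Summits.Ventures.PercRepro2.SwOutEdgeShadow
import Summits.Ventures.PercRepro2.SwOutEdgeShadowFlip

/-!
# The hull and the coarse arms at a one-sided point of an e-core cube and at its shadow points
(blind cell PercRepro2, night-4 g16, 2026-08-26; proofs/NIGHT4-G15.md §4 (L4),
proofs/NIGHT4-G16.md §4)

`SwOutCoreShadowArm` for an e-core base (the junction `u` adjacent to `h`).  At a one-sided
point `ω₀` — no blue h-arm adjacent to `u`; `u` is red through the h–u edge — and at every point
of its shadow cube the hull of `h` is `{h} ∪ sX ∪ (far arms)` (`hull_coreReal_oneSided_eq`,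
`hull_shadowReal_eq`; the dropped arms are outside).  With connected arms the coarse arms of `h`
at such a point are exactly `sX` and the far arms (`arm_u_eq_sX`, `arm_far_eq`,
`exists_sB_of_mem_arms`) — verbatim G14, the arm structure being the same.
-/

namespace Summit.Ventures.PercRepro2

namespace LocRows

open Hull

variable {V : Type*} {E : Type*} [Fintype E] [DecidableEq E]

open scoped Classical

variable {ends : E → Sym2 V}

section OneSided

variable {ι : Type*} {A : ι → Set V} {pure : ι → Prop} {ζ : Config E} {h u : V} {H : Set V}
  (hb : CoreBaseE ends ζ h u H A pure) {ω₀ : Config ι}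
  (huB : ¬ uRed ends A u pure (flipAll ω₀))
include hb huB

omit [Fintype E] [DecidableEq E] hb in
/-- «`u` not blue» on the e-cube point above `ω₀` (the h–u edges red). -/
lemma CoreBaseE.not_uRedE_flipAll_withHuRed :
    ¬ uRedE ends A u pure (flipAll (withHuRed ω₀)) := by
  rintro (hn | hr)
  · exact absurd hn (by simp [flipAll, withHuRed])
  · rw [flipAll_comp_some, withHuRed_comp_some] at hr
    exact huB hr

omit [Fintype E] [DecidableEq E] in
/-- **The hull at a one-sided point**: `h`, the coarse arm of `u` and the far arms (`u` is red
through the h–u edge; no blue h-arm is adjacent to `u`). -/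
theorem CoreBaseE.hull_coreReal_oneSided_eq :
    hull ends (coreReal ends A ζ ω₀) h = {h} ∪ {x | ∃ j, x ∈ sB ends u A ω₀ j} := by
  rw [← hb.coreRealE_withHuRed ω₀]
  have huR' : uRedE ends A u pure (withHuRed ω₀) := Or.inl rfl
  have huB' := CoreBaseE.not_uRedE_flipAll_withHuRed (A := A) (pure := pure) huB
  ext x
  simp only [hull, Set.mem_union, Set.mem_singleton_iff, Set.mem_setOf_eq]
  rw [hb.cluster_coreRealE, hb.cluster_blue_coreRealE, mem_redSetE_iff, mem_redSetE_iff]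
  constructor
  · rintro ((rfl | ⟨i, hi, hpi, hx⟩ | ⟨_, rfl | ⟨i, hi, hpi, hx⟩⟩) |
      (rfl | ⟨i, hi, hpi, hx⟩ | ⟨hu', _⟩))
    · exact Or.inl rfl
    · by_cases hadj : uAdjC ends u A i
      · exact Or.inr ⟨none, by simp only [sB]; exact mem_sX_iff.2 (Or.inr ⟨i, hadj, hi, hx⟩)⟩
      · exact Or.inr ⟨some ⟨i, hadj⟩, hx⟩
    · exact Or.inr ⟨none, by simp only [sB]; exact mem_sX_iff.2 (Or.inl rfl)⟩
    · refine Or.inr ⟨none, ?_⟩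
      simp only [sB]
      exact mem_sX_iff.2 (Or.inr ⟨i, hb.uAdjC_of_pure hpi, hi, hx⟩)
    · exact Or.inl rfl
    · by_cases hadj : uAdjC ends u A i
      · exfalso
        obtain ⟨e, y, huy, hy⟩ := hadj
        exact huB ⟨i, hi, hpi, e, y, huy, hy⟩
      · exact Or.inr ⟨some ⟨i, hadj⟩, hx⟩
    · exact absurd hu' huB'
  · rintro (rfl | ⟨j, hj⟩)
    · exact Or.inl (Or.inl rfl)
    · rcases j with _ | ⟨i, hadj⟩
      · simp only [sB] at hj
        rcases mem_sX_iff.1 hj with rfl | ⟨i, _, hi, hx⟩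
        · exact Or.inl (Or.inr (Or.inr ⟨huR', Or.inl rfl⟩))
        · by_cases hpi : pure i
          · exact Or.inl (Or.inr (Or.inr ⟨huR', Or.inr ⟨i, hi, hpi, hx⟩⟩))
          · exact Or.inl (Or.inr (Or.inl ⟨i, hi, hpi, hx⟩))
      · have hpi : ¬ pure i := hb.not_pure_of_not_uAdjC hadj
        cases hi : ω₀ i with
        | true => exact Or.inl (Or.inr (Or.inl ⟨i, hi, hpi, hj⟩))
        | false =>
          right; right; left
          exact ⟨i, by simp [flipAll, withHuRed, hi], hpi, hj⟩

omit [Fintype E] [DecidableEq E] in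
/-- **The hull at a shadow point**: `h`, the coarse arm of `u` and the far arms. -/
theorem CoreBaseE.hull_shadowReal_eq (ω' : Config (Option {i : ι // ¬ uAdjC ends u A i})) :
    hull ends (shadowReal ends (sB ends u A ω₀) (sZ ends u A ω₀) none
      (shadowOf ends u A ω₀ ζ) ω') h = {h} ∪ {x | ∃ j, x ∈ sB ends u A ω₀ j} := by
  have hs := hb.shadowBase (CoreBaseE.not_uRedE_flipAll_withHuRed (A := A) (pure := pure) huB)
  rw [withHuRed_comp_some] at hs
  ext x
  simp only [hull, Set.mem_union, Set.mem_singleton_iff, Set.mem_setOf_eq]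
  rw [hs.cluster_shadowReal, hs.cluster_blue_shadowReal, mem_sRed_iff, mem_sRed_iff]
  constructor
  · rintro ((rfl | ⟨j, _, hx⟩) | (rfl | ⟨j, _, hx⟩))
    · exact Or.inl rfl
    · exact Or.inr ⟨j, hx⟩
    · exact Or.inl rfl
    · exact Or.inr ⟨j, hx⟩
  · rintro (rfl | ⟨j, hj⟩)
    · exact Or.inl (Or.inl rfl)
    · cases hω : ω' j with
      | true => exact Or.inl (Or.inr ⟨j, hω, hj⟩)
      | false => exact Or.inr (Or.inr ⟨j, by simp only [flipAll, hω]; rfl, hj⟩)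

omit [Fintype E] [DecidableEq E] huB in
/-- A vertex of an arm lies in `{h} ∪ sX ∪ far` iff the arm is not dropped. -/
lemma CoreBaseE.mem_region_iff_of_mem_arm {i : ι} {x : V} (hx : x ∈ A i) :
    x ∈ {h} ∪ {x | ∃ j, x ∈ sB ends u A ω₀ j} ↔ (uAdjC ends u A i → ω₀ i = true) := by
  simp only [Set.mem_union, Set.mem_singleton_iff, Set.mem_setOf_eq]
  constructor
  · rintro (rfl | ⟨j, hj⟩) hadj
    · exact absurd hx (hb.h_notMem_arm i)
    · rcases j with _ | ⟨i', hi'⟩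
      · simp only [sB] at hj
        rcases mem_sX_iff.1 hj with rfl | ⟨i', hadj', hi', hx'⟩
        · exact absurd hx (hb.u_notMem_arm i)
        · have : i' = i := by
            by_contra hne
            exact hb.arm_disj i' i hne x hx' hx
          subst this; exact hi'
      · have : i' = i := by
          by_contra hne
          exact hb.arm_disj i' i hne x hj hx
        subst this; exact absurd hadj hi'
  · intro hi
    by_cases hadj : uAdjC ends u A i
    · exact Or.inr ⟨none, by simp only [sB]; exact mem_sX_iff.2 (Or.inr ⟨i, hadj, hi hadj, hx⟩)⟩
    · exact Or.inr ⟨some ⟨i, hadj⟩, hx⟩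

end OneSided

section Coarse

variable {ι : Type*} {A : ι → Set V} {pure : ι → Prop} {ζ : Config E} {h u : V} {H : Set V}
  (hb : CoreBaseE ends ζ h u H A pure) {ω₀ : Config ι} (hconn : ArmsConnected A ends)
  {η : Config E} (hH : hull ends η h = {h} ∪ {x | ∃ j, x ∈ sB ends u A ω₀ j})
include hb hconn hH

omit [Fintype E] [DecidableEq E] hconn in
/-- A vertex of `sX` or of a far arm lies in `hull ∖ {h}`. -/
lemma CoreBaseE.mem_hull_sdiff_of_mem_sB {j : Option {i : ι // ¬ uAdjC ends u A i}} {x : V}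
    (hx : x ∈ sB ends u A ω₀ j) : x ∈ hull ends η h ∧ x ≠ h := by
  refine ⟨by rw [hH]; exact Or.inr ⟨j, hx⟩, ?_⟩
  rintro rfl
  rcases j with _ | ⟨i, _⟩
  · simp only [sB] at hx
    rcases mem_sX_iff.1 hx with hh | ⟨i, _, _, hh⟩
    · exact hb.hne hh
    · exact hb.h_notMem_arm i hh
  · exact hb.h_notMem_arm i hx

omit [Fintype E] [DecidableEq E] hconn in
/-- No edge joins `sX` to a far arm. -/
lemma CoreBaseE.no_edge_sX_far {e : E} {x y : V} (hxy : ends e = s(x, y)) (hx : x ∈ sX ends u A ω₀)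
    {i : ι} (hi : ¬ uAdjC ends u A i) (hy : y ∈ A i) : False := by
  have hxu : x = u := hb.eq_u_of_edge_sX hxy hx hy (fun h' => hi h'.1)
  subst hxu
  exact hi ⟨e, y, hxy, hy⟩

omit [Fintype E] [DecidableEq E] in
/-- `sX` is a component of `G[hull ∖ {h}]`. -/
theorem CoreBaseE.isComp_sX : IsComp ends η h (sX ends u A ω₀) where
  closed := by
    refine ⟨fun x hx => hb.mem_hull_sdiff_of_mem_sB hH (j := none) hx, ?_⟩
    intro e x y hxy hx hyH hyh
    rw [hH] at hyH
    rcases hyH with hyh' | ⟨j, hyj⟩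
    · exact absurd hyh' hyh
    · rcases j with _ | ⟨i, hi⟩
      · exact hyj
      · exact absurd hyj (fun hyj => hb.no_edge_sX_far hH hxy hx hi hyj)
  conn := by
    -- every vertex of `sX` is joined to `u` inside `sX`
    have key : ∀ x ∈ sX ends u A ω₀, Conn ends (withinConfig ends (sX ends u A ω₀)) u x := by
      intro x hx
      rcases mem_sX_iff.1 hx with rfl | ⟨i, hadj, hi, hxi⟩
      · exact conn_refl _ _ _
      · obtain ⟨e, x₀, hux₀, hx₀⟩ := hadj
        have hx₀X : x₀ ∈ sX ends u A ω₀ := mem_sX_iff.2 (Or.inr ⟨i, ⟨e, x₀, hux₀, hx₀⟩, hi, hx₀⟩)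
        have h1 : Conn ends (withinConfig ends (sX ends u A ω₀)) u x₀ :=
          conn_of_openAdj ⟨e, withinConfig_eq_true_iff.2
            ⟨u, mem_sX_iff.2 (Or.inl rfl), x₀, hx₀X, hux₀⟩, hux₀⟩
        have h2 : Conn ends (withinConfig ends (sX ends u A ω₀)) x₀ x := by
          refine conn_mono (withinConfig_mono ?_) (hconn i x₀ hx₀ x hxi)
          intro v hv
          exact mem_sX_iff.2 (Or.inr ⟨i, ⟨e, x₀, hux₀, hx₀⟩, hi, hv⟩)
        exact conn_trans h1 h2
    intro x hx y hy
    exact conn_trans (conn_symm (key x hx)) (key y hy)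

omit [Fintype E] [DecidableEq E] in
/-- A far arm is a component of `G[hull ∖ {h}]`. -/
theorem CoreBaseE.isComp_far {i : ι} (hi : ¬ uAdjC ends u A i) : IsComp ends η h (A i) where
  closed := by
    refine ⟨fun x hx => hb.mem_hull_sdiff_of_mem_sB hH (j := some ⟨i, hi⟩) hx, ?_⟩
    intro e x y hxy hx hyH hyh
    rw [hH] at hyH
    rcases hyH with hyh' | ⟨j, hyj⟩
    · exact absurd hyh' hyh
    · rcases j with _ | ⟨i', hi'⟩
      · exact absurd hyj (fun hyj => hb.no_edge_sX_far hH (ends_swap hxy) hyj hi hx)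
      · have : i = i' := hb.arm_eq_of_edge hxy hx hyj
        subst this; exact hyj
  conn := fun x hx y hy => hconn i x hx y hy

omit [Fintype E] [DecidableEq E] in
/-- **The coarse arm of `u` is `sX`.** -/
theorem CoreBaseE.arm_u_eq_sX : arm ends η h u = sX ends u A ω₀ :=
  arm_eq_of_isComp (hb.isComp_sX hconn hH) (mem_sX_iff.2 (Or.inl rfl))

omit [Fintype E] [DecidableEq E] in
/-- **The coarse arm of a far vertex is its far arm.** -/
theorem CoreBaseE.arm_far_eq {i : ι} (hi : ¬ uAdjC ends u A i) {x : V} (hx : x ∈ A i) :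
    arm ends η h x = A i :=
  arm_eq_of_isComp (hb.isComp_far hconn hH hi) hx

omit [DecidableEq E] in
/-- **The coarse arms are `sX` and the far arms.** -/
theorem CoreBaseE.exists_sB_of_mem_arms {P : Set V} (hP : P ∈ arms ends η h) :
    ∃ j, P = sB ends u A ω₀ j := by
  refine exists_eq_of_mem_arms (C := sB ends u A ω₀) ?_ ?_ hP
  · rintro (_ | ⟨i, hi⟩)
    · exact hb.isComp_sX hconn hH
    · exact hb.isComp_far hconn hH hi
  · intro x hxH hxh
    rw [hH] at hxH
    rcases hxH with rfl | ⟨j, hj⟩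
    · exact absurd rfl hxh
    · exact ⟨j, hj⟩

omit [DecidableEq E] in
/-- `sX` is a coarse arm. -/
theorem CoreBaseE.sX_mem_arms : sX ends u A ω₀ ∈ arms ends η h :=
  mem_arms_of_isComp (hb.isComp_sX hconn hH) ⟨u, mem_sX_iff.2 (Or.inl rfl)⟩

omit [DecidableEq E] in
/-- A far arm is a coarse arm. -/
theorem CoreBaseE.far_mem_arms {i : ι} (hi : ¬ uAdjC ends u A i) : A i ∈ arms ends η h :=
  mem_arms_of_isComp (hb.isComp_far hconn hH hi) (hb.arm_nonempty i)

end Coarse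

end LocRows

end Summit.Ventures.PercRepro2
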